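import Mathlib
import Literature.Algebra.EuclideanLattices.DualLattice
import HarnessLib

/-!
# Stub `stub_persistence` of line `Sketch` (crux `MagicFunctionsPersist`, stmt-PneNP-2328)

Persistence of a dual cosine sum at a HALF-LATTICE point.  For a full-rank lattice `L ⊆ ℝⁿ`
(`n ≥ 1`), a lattice vector `v ∈ L` and a radius `0 ≤ d < dist(v/2, L)`, there are `n` dual
vectors `w₁, …, wₙ ∈ L*` and a threshold `θ` with
`∑ⱼ cos 2π⟪wⱼ, v/2⟫ < nθ ≤ ∑ⱼ cos 2π⟪wⱼ, x⟫` for every `x` within distance `d` of `L`.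

Proof.  Fix a `ℤ`-basis `b` of `L` and its inner-product dual basis `b^∨` (`⟪b^∨ᵢ, bⱼ⟫ = δᵢⱼ`,
a `ℤ`-basis of `L*`).  Writing `v = ∑ aⱼ bⱼ`, some `a_{i₀}` is odd (otherwise `v/2 ∈ L`); put
`wⱼ := b^∨ⱼ + [aⱼ even] b^∨_{i₀}`.  Then every `⟪wⱼ, v⟫` is an odd integer, so the sum at `v/2`
is `-n`.  The sum `f` is `L`-periodic and continuous, so on the closed `d`-tube around `L` it is
bounded below by its minimum `f(e₀)` over the compact ball `‖e‖ ≤ d`; and `f(e₀) = -n` would force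
`⟪wⱼ, e₀ - v/2⟫ ∈ ℤ` for all `j`, hence (the `wⱼ` generate `L*` unimodularly, so
`⟪b^∨ⱼ, e₀ - v/2⟫ ∈ ℤ`, i.e. all `b`-coordinates of `e₀ - v/2` are integers) `e₀ - v/2 ∈ L`,
contradicting `‖e₀‖ ≤ d < dist(v/2, L)`.  Take `θ := f(e₀)/n`.
-/

set_option linter.dupNamespace false

noncomputable section

open scoped InnerProductSpace
open Literature.Algebra.EuclideanLattices Module

namespace Summit.PneNP.PneNP.Theorems.LatticeMagicMagicFunctionsPersist

namespace Persistence

variable {E : Type*} [NormedAddCommGroup E] [InnerProductSpace ℝ E]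

/-- For an `ℝ`-basis `B` of a (finite-dimensional) real inner product space and its inner-product
dual basis `B^∨` (`⟪B^∨ᵢ, Bⱼ⟫ = δᵢⱼ`), pairing with `B^∨ᵢ` reads off the `i`-th coordinate:
`⟪B^∨ᵢ, x⟫ = (B.repr x)ᵢ`. [folklore] -/
theorem inner_dualBasis_eq_repr {ι : Type*} [Fintype ι] [DecidableEq ι] (B : Basis ι ℝ E)
    (x : E) (i : ι) :
    ⟪LinearMap.BilinForm.dualBasis (innerₗ E : LinearMap.BilinForm ℝ E) innerₗ_nondegenerate B i,
      x⟫_ℝ = B.repr x i := by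
  have hs : LinearMap.BilinForm.IsSymm (innerₗ E : LinearMap.BilinForm ℝ E) :=
    LinearMap.BilinForm.isSymm_iff.mpr isSymm_inner
  have h := LinearMap.BilinForm.dualBasis_repr_apply (B := (innerₗ E : LinearMap.BilinForm ℝ E))
    innerₗ_nondegenerate (LinearMap.BilinForm.dualBasis (innerₗ E : LinearMap.BilinForm ℝ E)
      innerₗ_nondegenerate B) x i
  rw [LinearMap.BilinForm.dualBasis_dualBasis innerₗ_nondegenerate hs] at h
  rw [h, innerₗ_apply_apply]
  exact real_inner_comm _ _

variable [FiniteDimensional ℝ E]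

/-- If all coordinates of `e` in (the `ℝ`-basis induced by) a `ℤ`-basis `b` of the lattice `L`
are integers, then `e ∈ L`. [folklore] -/
theorem mem_of_repr_ofZLatticeBasis_int {ι : Type*} [Fintype ι] (L : Submodule ℤ E)
    [DiscreteTopology L] [IsZLattice ℝ L] (b : Basis ι ℤ L) {e : E}
    (h : ∀ i, ∃ m : ℤ, (m : ℝ) = (b.ofZLatticeBasis ℝ L).repr e i) : e ∈ L := by
  rw [← (b.ofZLatticeBasis ℝ L).sum_repr e]
  refine Submodule.sum_mem _ fun i _ => ?_
  obtain ⟨m, hm⟩ := h i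
  rw [← hm, Basis.ofZLatticeBasis_apply, Int.cast_smul_eq_zsmul ℝ m]
  exact zsmul_mem (b i).2 m

/-- **Tube minimum of a dual cosine sum.** For dual vectors `wⱼ ∈ L*` of a discrete `L` and
`d ≥ 0`, the `L`-periodic continuous sum `f(x) = ∑ⱼ cos 2π⟪wⱼ, x⟫` attains on the closed ball
`‖e‖ ≤ d` a value `f(e₀)` which bounds `f` from below on the whole closed `d`-tube around `L`
(a closest lattice point exists since `L` is closed and the space is proper). [folklore] -/
theorem exists_ball_min_le_tube {ι : Type*} [Fintype ι] (L : Submodule ℤ E) [DiscreteTopology L]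
    {w : ι → E} (hw : ∀ j, w j ∈ dualLattice L) {d : ℝ} (hd : 0 ≤ d) :
    ∃ e₀ ∈ Metric.closedBall (0 : E) d, ∀ x : E, Metric.infDist x (L : Set E) ≤ d →
      ∑ j, Real.cos (2 * Real.pi * ⟪w j, e₀⟫_ℝ) ≤ ∑ j, Real.cos (2 * Real.pi * ⟪w j, x⟫_ℝ) := by
  have hcont : Continuous fun x : E => ∑ j, Real.cos (2 * Real.pi * ⟪w j, x⟫_ℝ) := by
    fun_prop
  obtain ⟨e₀, he₀, hmin⟩ := (isCompact_closedBall (0 : E) d).exists_isMinOn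
    ⟨0, Metric.mem_closedBall_self hd⟩ hcont.continuousOn
  refine ⟨e₀, he₀, fun x hx => ?_⟩
  have hclosed : IsClosed (X := E) L :=
    @AddSubgroup.isClosed_of_discrete _ _ _ _ _ L.toAddSubgroup
      (inferInstanceAs (DiscreteTopology L))
  obtain ⟨y, hy, hxy⟩ := hclosed.exists_infDist_eq_dist ⟨0, L.zero_mem⟩ x
  have hmem : x - y ∈ Metric.closedBall (0 : E) d := by
    rw [mem_closedBall_zero_iff, ← dist_eq_norm, ← hxy]
    exact hx
  have hper : ∑ j, Real.cos (2 * Real.pi * ⟪w j, x - y⟫_ℝ) =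
      ∑ j, Real.cos (2 * Real.pi * ⟪w j, x⟫_ℝ) := by
    refine Finset.sum_congr rfl fun j _ => ?_
    obtain ⟨m, hm⟩ := mem_dualLattice.mp (hw j) y hy
    rw [inner_sub_right, ← hm, mul_sub,
      show 2 * Real.pi * (m : ℝ) = m * (2 * Real.pi) by ring, Real.cos_sub_int_mul_two_pi]
  rw [← hper]
  exact (isMinOn_iff.mp hmin) (x - y) hmem

end Persistence

/-- **Persistence at a half-lattice point.** If `v ∈ L` and the half point `t = v/2` is at
distance `> d ≥ 0` from the full-rank lattice `L ⊆ ℝⁿ` (`n ≥ 1`), then some `n` dual vectors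
`w_j ∈ L*` and a threshold `θ` give `∑_j cos 2π⟪w_j, t⟫ < nθ ≤ ∑_j cos 2π⟪w_j, x⟫` for every `x`
within `d` of `L`. (Take a `ℤ`-basis of `L*` in the odd class `{w : ⟪w, v⟫ odd}`: the sum is `-n`
at `t`, and `= -n` at `x` forces `x ∈ t + L`; minimise over the compact tube.) -/
theorem stub_persistence {n : ℕ} (hn : 0 < n) (L : Submodule ℤ (EuclideanSpace ℝ (Fin n)))
    [DiscreteTopology L] [IsZLattice ℝ L] {v : EuclideanSpace ℝ (Fin n)} (hv : v ∈ L)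
    {d : ℝ} (hd : 0 ≤ d)
    (hdv : d < Metric.infDist ((1 / 2 : ℝ) • v) (L : Set (EuclideanSpace ℝ (Fin n)))) :
    ∃ w : Fin n → EuclideanSpace ℝ (Fin n), (∀ j, w j ∈ dualLattice L) ∧ ∃ θ : ℝ,
      (∑ j, Real.cos (2 * Real.pi * ⟪w j, (1 / 2 : ℝ) • v⟫_ℝ)) < n * θ ∧
      ∀ x : EuclideanSpace ℝ (Fin n), Metric.infDist x (L : Set (EuclideanSpace ℝ (Fin n))) ≤ d →
        (n : ℝ) * θ ≤ ∑ j, Real.cos (2 * Real.pi * ⟪w j, x⟫_ℝ) := by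
  -- A `ℤ`-basis `b` of `L` indexed by `Fin n`, the induced `ℝ`-basis `B` of `ℝⁿ`, its dual `bd`.
  have hrank : Module.finrank ℤ L = n := (ZLattice.rank ℝ L).trans finrank_euclideanSpace_fin
  let b : Basis (Fin n) ℤ L := Module.finBasisOfFinrankEq ℤ L hrank
  let B : Basis (Fin n) ℝ (EuclideanSpace ℝ (Fin n)) := b.ofZLatticeBasis ℝ L
  let bd : Basis (Fin n) ℝ (EuclideanSpace ℝ (Fin n)) := LinearMap.BilinForm.dualBasis
    (innerₗ (EuclideanSpace ℝ (Fin n)) : LinearMap.BilinForm ℝ (EuclideanSpace ℝ (Fin n)))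
    innerₗ_nondegenerate B
  have hbd_inner : ∀ i x, ⟪bd i, x⟫_ℝ = B.repr x i := fun i x =>
    Persistence.inner_dualBasis_eq_repr B x i
  have hbd_mem : ∀ i, bd i ∈ dualLattice L := fun i => by
    rw [dualLattice_eq_span_dualBasis L b]
    exact Submodule.subset_span ⟨i, rfl⟩
  have hmemL : ∀ e : EuclideanSpace ℝ (Fin n), (∀ i, ∃ m : ℤ, (m : ℝ) = B.repr e i) → e ∈ L :=
    fun e he => Persistence.mem_of_repr_ofZLatticeBasis_int L b he
  -- The integer coordinates `a` of `v`; one of them, `a i₀`, is odd since `v/2 ∉ L`.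
  obtain ⟨a, ha⟩ : ∃ a : Fin n → ℤ, ∀ j, B.repr v j = (a j : ℝ) :=
    ⟨fun j => b.repr ⟨v, hv⟩ j, fun j => b.ofZLatticeBasis_repr_apply ℝ L ⟨v, hv⟩ j⟩
  have htL : (1 / 2 : ℝ) • v ∉ L := fun h => by
    have h0 := Metric.infDist_zero_of_mem (s := (L : Set (EuclideanSpace ℝ (Fin n)))) h
    linarith
  obtain ⟨i₀, hi₀⟩ : ∃ i₀, Odd (a i₀) := by
    by_contra hall
    push Not at hall
    refine htL (hmemL _ fun i => ?_)
    obtain ⟨k, hk⟩ := Int.not_odd_iff_even.mp (hall i)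
    refine ⟨k, ?_⟩
    rw [map_smul, Finsupp.smul_apply, ha, hk, smul_eq_mul]
    push_cast
    ring
  -- The dual vectors `w j := bd j + c j • bd i₀`, `c j := [a j even]`, pair oddly with `v`.
  obtain ⟨c, hc1, hc0⟩ : ∃ c : Fin n → ℤ, (∀ j, Even (a j) → c j = 1) ∧
      (∀ j, ¬ Even (a j) → c j = 0) :=
    ⟨fun j => if Even (a j) then 1 else 0, fun j hj => if_pos hj, fun j hj => if_neg hj⟩
  have hci₀ : c i₀ = 0 := hc0 i₀ (Int.not_even_iff_odd.mpr hi₀)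
  have hodd : ∀ j, Odd (a j + c j * a i₀) := by
    intro j
    by_cases hj : Even (a j)
    · rw [hc1 j hj, one_mul]
      exact hj.add_odd hi₀
    · rw [hc0 j hj, zero_mul, add_zero]
      exact Int.not_even_iff_odd.mp hj
  have hw : ∀ j, bd j + (c j : ℝ) • bd i₀ ∈ dualLattice L := fun j =>
    add_mem (hbd_mem j) (by rw [Int.cast_smul_eq_zsmul ℝ (c j)]; exact zsmul_mem (hbd_mem i₀) _)
  have hw_inner : ∀ j (y : EuclideanSpace ℝ (Fin n)),
      ⟪bd j + (c j : ℝ) • bd i₀, y⟫_ℝ = B.repr y j + c j * B.repr y i₀ := by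
    intro j y
    rw [inner_add_left, real_inner_smul_left, hbd_inner, hbd_inner]
  have hv2 : ∀ j, ∃ m : ℤ, B.repr v j + c j * B.repr v i₀ = 2 * m + 1 := by
    intro j
    obtain ⟨m, hm⟩ := hodd j
    refine ⟨m, ?_⟩
    rw [ha, ha]
    exact_mod_cast hm
  refine ⟨fun j => bd j + (c j : ℝ) • bd i₀, hw, ?_⟩
  -- The value at `t = v/2` is `-n`.
  have hval : ∑ j, Real.cos (2 * Real.pi * ⟪bd j + (c j : ℝ) • bd i₀, (1 / 2 : ℝ) • v⟫_ℝ)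
      = -n := by
    have hterm : ∀ j, Real.cos (2 * Real.pi * ⟪bd j + (c j : ℝ) • bd i₀, (1 / 2 : ℝ) • v⟫_ℝ)
        = -1 := by
      intro j
      obtain ⟨m, hm⟩ := hv2 j
      have h2 : 2 * Real.pi * ⟪bd j + (c j : ℝ) • bd i₀, (1 / 2 : ℝ) • v⟫_ℝ
          = m * (2 * Real.pi) + Real.pi := by
        rw [inner_smul_right, hw_inner, hm]
        ring
      rw [h2]
      exact Real.cos_int_mul_two_pi_add_pi m
    simp only [hterm, Finset.sum_const, Finset.card_univ, Fintype.card_fin, nsmul_eq_mul, mul_neg,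
      mul_one]
  -- Minimum over the compact ball / the closed tube.
  obtain ⟨e₀, he₀, hmin⟩ := Persistence.exists_ball_min_le_tube L hw hd
  have hn' : (n : ℝ) ≠ 0 := Nat.cast_ne_zero.mpr hn.ne'
  refine ⟨(∑ j, Real.cos (2 * Real.pi * ⟪bd j + (c j : ℝ) • bd i₀, e₀⟫_ℝ)) / n, ?_, fun x hx => by
    rw [mul_div_cancel₀ _ hn']; exact hmin x hx⟩
  rw [mul_div_cancel₀ _ hn']
  refine hval.trans_lt ?_
  -- Strictness: `f(e₀) = -n` would put `e₀ - v/2` in `L`.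
  by_contra hle
  push Not at hle
  have hcos : ∀ j, Real.cos (2 * Real.pi * ⟪bd j + (c j : ℝ) • bd i₀, e₀⟫_ℝ) = -1 := by
    have hnn : ∀ j ∈ (Finset.univ : Finset (Fin n)),
        0 ≤ Real.cos (2 * Real.pi * ⟪bd j + (c j : ℝ) • bd i₀, e₀⟫_ℝ) + 1 := fun j _ => by
      linarith [Real.neg_one_le_cos (2 * Real.pi * ⟪bd j + (c j : ℝ) • bd i₀, e₀⟫_ℝ)]
    have hsum : ∑ j, (Real.cos (2 * Real.pi * ⟪bd j + (c j : ℝ) • bd i₀, e₀⟫_ℝ) + 1) = 0 := by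
      refine le_antisymm ?_ (Finset.sum_nonneg hnn)
      rw [Finset.sum_add_distrib, Finset.sum_const, Finset.card_univ, Fintype.card_fin,
        nsmul_eq_mul, mul_one]
      linarith
    intro j
    have h := (Finset.sum_eq_zero_iff_of_nonneg hnn).mp hsum j (Finset.mem_univ j)
    linarith
  -- all pairings of `e₀ - v/2` with the `w j` are integers
  have hint : ∀ j, ∃ m : ℤ, (m : ℝ) = B.repr (e₀ - (1 / 2 : ℝ) • v) j +
      c j * B.repr (e₀ - (1 / 2 : ℝ) • v) i₀ := by
    intro j
    obtain ⟨k, hk⟩ := Real.cos_eq_neg_one_iff.mp (hcos j)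
    obtain ⟨m, hm⟩ := hv2 j
    have hk' : B.repr e₀ j + c j * B.repr e₀ i₀ = 1 / 2 + k := by
      rw [← hw_inner]
      refine mul_left_cancel₀ (show (2 * Real.pi) ≠ 0 by positivity) ?_
      rw [← hk]
      ring
    refine ⟨k - m, ?_⟩
    simp only [map_sub, map_smul, Finsupp.sub_apply, Finsupp.smul_apply, smul_eq_mul]
    push_cast
    linear_combination (1 / 2 : ℝ) * hm - hk'
  -- hence all its `b`-coordinates are integers, so it lies in `L`
  have hmem : e₀ - (1 / 2 : ℝ) • v ∈ L := by
    refine hmemL _ fun j => ?_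
    obtain ⟨m₁, hm₁⟩ := hint j
    obtain ⟨m₀, hm₀⟩ := hint i₀
    rw [hci₀, Int.cast_zero, zero_mul, add_zero] at hm₀
    rw [← hm₀] at hm₁
    refine ⟨m₁ - c j * m₀, ?_⟩
    push_cast
    linarith
  have hmem' : (1 / 2 : ℝ) • v - e₀ ∈ L := by
    rw [← neg_sub]
    exact L.neg_mem hmem
  have h1 := Metric.infDist_le_dist_of_mem (x := (1 / 2 : ℝ) • v)
    (s := (L : Set (EuclideanSpace ℝ (Fin n)))) hmem'
  rw [dist_eq_norm, sub_sub_cancel] at h1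
  have h2 : ‖e₀‖ ≤ d := mem_closedBall_zero_iff.mp he₀
  linarith

end Summit.PneNP.PneNP.Theorems.LatticeMagicMagicFunctionsPersist

end
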